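import Mathlib
import Summits.KontsevichZagierPeriods.Zeta5Search.Elimination.QBoundaryForm
import Summits.KontsevichZagierPeriods.Zeta5Search.Families.DualExactFullCone
import HarnessLib

/-!
# The constant-term side of the boundary descent, hypothesis-free: `CTBoundaryForm` holds (cell `pub-zeta5`, seat ct-1 g25)

HONEST FRAMING: systematic search; no irrationality claim unless certified.  MODUS PONENS ONLY over landed theorems.  fam-elim
E-L30's `Elimination/BoundaryDescent` TYPED the constant-term companions of its `Q`-side boundary laws as HYPOTHESES (the
`@[conjecture]` node `CTBoundaryForm` and the schemas `CTBoundaryAbs W`, `CTTerminalAbs W`, `CTTwoTermBoundary W` at the cone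
guard `W = DualCone`), at a time when CONJECTURE D-exact `|Q(a)| = CT(a)` was open.  Both inputs are now theorems of the tree:
cert-2 g8's `Families.Cellular.DualR.leadingCoeffIsDualConstantTerm_holds` (D-exact for all `a` with `bzNum a, bzDen a ≥ 0`,
`Families/DualExactFullCone`) and fam-elim E-L31's `Elimination.qBoundaryForm_holds` / `qTwoTermBoundary_holds`
(`Elimination/QBoundaryForm`).  This file feeds the former into the latter:

* `abs_QOf_eq_ct_of_region` — `|Q(a)| = CT(a)` at every point of gen-1's region inside the cone (`RegionHyp a j`, `DualCone a`);
* `ctBoundaryAbs_dualCone : CTBoundaryAbs DualCone`, `ctTerminalAbs_dualCone : CTTerminalAbs DualCone` (the two unsigned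
  value nodes of E-L29/E-L30 at the cone guard);
* **`ctBoundaryForm_holds : CTBoundaryForm`** — the `@[conjecture]` node: at every boundary point of region ∩ cone the dual constant
  term is the closed form `BF(b(a))` (`qBoundaryForm_holds` + D-exact);
* `ctTwoTermBoundary_dualCone : CTTwoTermBoundary DualCone` — the constant-term two-term law at boundary cone points
  (`qTwoTermBoundary_holds` + D-exact at `a` and `a − s_i`; the `Q`-side coefficients `b_i(N+1−b_i) ≥ 0`).

Integer identities about Brown–Zudilin's leading coefficient (17) and cert-2's dual constant term; no new node, no `def`;
nothing about `ζ(5)`; records in print unmoved.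
-/

open Finset

namespace Summit.KontsevichZagierPeriods.Zeta5Search.Elimination

open Summit.KontsevichZagierPeriods.Zeta5Search.WedgeDictionary
open Summit.KontsevichZagierPeriods.Zeta5Search.Families.Cellular (dualConstantTerm bzNum bzDen)
open Summit.KontsevichZagierPeriods.Zeta5Search.Families.Cellular.DualR (leadingCoeffIsDualConstantTerm_holds)
open Literature.NumberTheory.Irrationality.BrownZudilin2022 (bOfA Converges QOf)

/-- **D-exact on gen-1's region inside the cone**: `|Q(a)| = CT(a)` whenever `RegionHyp a j` (so `a` converges and
`bzNum a ≥ 0`, `bzNum_nonneg`) and `DualCone a` (`bzDen a ≥ 0`) — cert-2 g8's `leadingCoeffIsDualConstantTerm_holds`. [folklore] -/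
theorem abs_QOf_eq_ct_of_region {a : Fin 8 → ℤ} {j : ℕ} (hr : RegionHyp a j) (hW : DualCone a) :
    |QOf a| = dualConstantTerm a :=
  leadingCoeffIsDualConstantTerm_holds a (bzNum_nonneg hr.2.1) hW

/-- **The boundary value node at the cone guard holds**: `CTBoundaryAbs DualCone`. [folklore] -/
theorem ctBoundaryAbs_dualCone : CTBoundaryAbs DualCone := fun _ _ hr hW _ => abs_QOf_eq_ct_of_region hr hW

/-- **The terminal value node at the cone guard holds**: `CTTerminalAbs DualCone`. [folklore] -/
theorem ctTerminalAbs_dualCone : CTTerminalAbs DualCone := fun _ _ hr hW _ => abs_QOf_eq_ct_of_region hr hW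

/-- **The `@[conjecture]` node `CTBoundaryForm` holds**: at every boundary point of gen-1's region inside Brown–Zudilin's cone,
`CT(a) = BF(b(a))` — E-L31's `qBoundaryForm_holds` (`|Q(a)| = BF(b(a))`) and D-exact. [folklore] -/
theorem ctBoundaryForm_holds : CTBoundaryForm := by
  intro a j hr hW hz
  rw [← qBoundaryForm_holds a j hr hW hz, ← abs_QOf_eq_ct_of_region hr hW, Int.cast_abs]

/-- **The constant-term two-term law at boundary cone points holds**: `CTTwoTermBoundary DualCone`, i.e.
`b_i(N+1−b_i)·CT(a) = |χ_iΠ_i(b)|·CT(a − s_i)` for every slot `i` with `b_i ≥ 1` at a boundary point of region ∩ cone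
(`qTwoTermBoundary_holds`, absolute values, and D-exact at `a` and at `a − s_i`, which stays in region ∩ cone by
`regionHyp_slotDown` / `dualCone_add_slotDown`). [folklore] -/
theorem ctTwoTermBoundary_dualCone : CTTwoTermBoundary DualCone := by
  intro a j i hr hW hz hi hi1
  have hq := qTwoTermBoundary_holds a j i hr hW hz hi hi1
  have hr' : RegionHyp (a + slotDown i) j := regionHyp_slotDown hr hi hi1
  have hW' : DualCone (a + slotDown i) := dualCone_add_slotDown hW hi hi1
  rw [← abs_QOf_eq_ct_of_region hr hW, ← abs_QOf_eq_ct_of_region hr' hW']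
  have hN := (region_box hr) i hi
  have hcoef : 0 ≤ bOfA a i * (bOfA a 0 + 1 - bOfA a i) := mul_nonneg hN.1 (by omega)
  have h1 : bOfA a i * (bOfA a 0 + 1 - bOfA a i) * QOf a = -(fanCoeff (bOfA a) i * QOf (a + slotDown i)) := by
    linarith
  have h2 := congrArg (fun z : ℤ => |z|) h1
  simp only [abs_neg, abs_mul, abs_of_nonneg hcoef] at h2
  exact h2

end Summit.KontsevichZagierPeriods.Zeta5Search.Elimination
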